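/- Copyright: the b2b-balaban cell (near-miss cell 7), T⁴-continuum fan-out, NE7b swarm leaf 04 (road W-RP-VAR,
supplier for row W4's chessboard fields).  Released under the licence of the surrounding project. -/
import Literature.Probability.LatticeModels.ChessboardEstimateEvenTorus
import Mathlib.Algebra.QuadraticDiscriminant
import Literature.MathematicalPhysics.QuantumFieldTheory.LatticeRPSignRule

/-!
# History chessboard road: the chessboard fields `hcs` FROM reflection positivity (memo step S5)

Summits-side support leaf of the T⁴-continuum cell (rung (B)+1 on a FINITE torus only; NOT infinite volume, NOT the
mass gap, NOT the Clay statement; NOT a proof of the spine estimate NE7b).  Row W5 of the secondary road W-RP-VAR of the swarm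
claim table `t4/b2b-balaban-t4-ne7b-p1/LEAVES-NE7b.md` (v3.19; owner ruling R-OWNER-23-2, booking l.13286); memo
`t4/b2b-balaban-t4-ne7-p2/g27/IDEAS-NE7-g27.md` §1, first checkable step (S5) «the Cauchy–Schwarz field `hcs` of
`chessboard_pow_le_even` for `ψ_S = ⟨∏ 1_{E_c}⟩` from an abstract RP functional».  A SUPPLIER for row W4's displayed
chessboard fields (owner spec v3.17: `h0`, `hempty`, `hcs : ∀ i k S, ψ S ^ 2 ≤ ψ (symP i k S) * ψ (symM i k S)` per
cutoff and tiling, displayed AS (RP-ext)+(VAR)+(R-sym)); nobody is obliged to consume it.  [folklore] finite algebra over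
the tree's block-torus symmetrisations (`Literature.Barriers.CriticalPhenomena.NonGibbs.{BlockIdx, cellReflect, halfPlus,
halfMinus, symP, symM}`); Mathlib + `ChessboardEstimateEvenTorus` + `LatticeRPSignRule` (for the definition `IsReflectionPositiveBdd`) only; nothing is quoted from print and nothing printed is
asserted; no `[cite:]` tag; no `def`.  The computation is the tree's model-specific
`PositionSpaceRGNonGibbsianPinnedTorus.tExpect_prodBad_sq_le` made abstract.

CURRENCY.  An «expectation» `E : (Ω → ℝ) → ℝ` on an abstract configuration type `Ω`, cell observables
`b : BlockIdx d N → Ω → ℝ` (in the road: `b c = 𝟙_{E_c}`, the indicator that cell `c` of one shifted tiling contains in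
its interior a deep chain of large-field creations — docstring reading only), and the cell-pattern functional
`ψ S = E (∏_{c ∈ S} b c)` (hypothesis `hψ`; W4 keeps its own `ψ`).  Per block hyperplane `(i, k)`: a configuration
reflection `θ : Ω → Ω` and

* (RP-CS) `hRP`: REFLECTION CAUCHY–SCHWARZ of the state for products of positive-half cell observables —
  `E (f · g∘θ) ^ 2 ≤ E (f · f∘θ) · E (g · g∘θ)` for `f = ∏_{c ∈ P} b c`, `g = ∏_{c ∈ Q} b c`, `P, Q ⊆ halfPlus N i k`
  (the consequence of reflection positivity `0 ≤ E (F · F∘θ)` on the positive algebra that the chessboard estimate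
  uses; §3 derives it from positivity + left-linearity + symmetry of the form, for consumers who display RP itself);
* (R-sym) `hcov`: the cell observables are REFLECTION-RELATED — `b c (θ σ) = b (cellReflect i k c) σ`.

WHAT.  §1 products of cell observables under the reflection (`prod_comp_reflect`, the split
`∏_S = ∏_{S ∩ H₊} · (∏_{θ(S ∩ H₋)}) ∘ θ`, and the two squares `∏_{symP S}`, `∏_{symM S}`).  §2 **`sq_le_symP_mul_symM`** ∕
**`hcs_of_rpCS`**: (RP-CS) + (R-sym) ⇒ `ψ S ^ 2 ≤ ψ (symP i k S) * ψ (symM i k S)` — W4's field `hcs` (row W5); and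
the two cheap fields `h0` (`E` positive, `0 ≤ b`) and `hempty` (`E 1 ≤ 1`).  §3 `rpCS_of_rp`: on a class of
observables closed under linear combinations, LEFT-LINEARITY of the reflected form `E (F · G∘θ)`, its SYMMETRY
`E (F · G∘θ) = E (G · F∘θ)` and POSITIVITY `0 ≤ E (F · F∘θ)` give (RP-CS) on that class (discriminant argument), and
`sq_le_symP_mul_symM_of_rp` = §2 fed by it.  §3b **`sq_le_symP_mul_symM_of_isReflectionPositiveBdd`**: the same from
the TREE's bounded reflection positivity of a finite MEASURE `LatticeRP.IsReflectionPositiveBdd μ mP θ` (file `LatticeRPSignRule`; the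
form proved for Wilson's lattice gauge theory), `θ` a measure-preserving involution, `ψ S = ∫ ∏_{c ∈ S} b c dμ` with
bounded cell observables, `mP`-measurable on the positive half; `chessboardFields_of_isReflectionPositiveBdd` packages
`h0`∕`hempty`∕`hcs` for all hyperplanes = the hypotheses of W2's `density_le_of_rp'`.  §4 sanity (`norm_num`∕`nlinarith` controls).

HONEST.  Nothing of Bałaban's averaging prescriptions, of (VAR), of the extended measure (EXT) or of the events `E_c` is
instantiated: `Ω`, `E`, `θ`, `b` are abstract and every property used is a displayed hypothesis.  Whether the CENTRED
prescription's extended state satisfies reflection positivity across block hyperplanes is W4's displayed binder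
(RP-ext)+(VAR) (NEW-UNPRINTED; it FAILS for the printed corner prescription, `t4/T4-EST-NE7b-P1.md` (11c)); this file only
shows which TWO sentences the `#{(i,k,S)}` Cauchy–Schwarz instances of W4's `hcs` reduce to.  NE7b NOT proved; spine
0∕9.  HONEST DEPENDENCY (cell): continuum YM on T⁴ ⇐ BetaPertH ∧ nine spine estimates (0/9 proved); BetaPertH ⇐ (D1) ∧
(D4) ∧ CAP+tail; G-an2-4 gates asym, D1 and NE2/3/4. -/

open Finset
open Literature.Barriers.CriticalPhenomena.NonGibbs Literature.Probability.LatticeModels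
open Literature.MathematicalPhysics.QuantumFieldTheory.LatticeRP (IsReflectionPositiveBdd)

namespace Summit.QuantumFields.BalabanUV.T4Continuum.HistoryChessboardRP

noncomputable section

variable {Ω : Type*} {d N : ℕ}

/-! ## §1 Products of cell observables under the reflection -/

section Products

variable (b : BlockIdx d N → Ω → ℝ) (i : Fin d) (k : ZMod N) {θ : Ω → Ω}

/-- (R-sym) transports products: `(∏_{c ∈ T} b c) (θ σ) = ∏_{c ∈ θT} b c σ` with `θT = T.image (cellReflect i k)`.
[folklore] -/
theorem prod_comp_reflect (hcov : ∀ c σ, b c (θ σ) = b (cellReflect i k c) σ) (T : Finset (BlockIdx d N)) (σ : Ω) :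
    ∏ c ∈ T, b c (θ σ) = ∏ c ∈ T.image (cellReflect i k), b c σ := by
  rw [prod_image fun c _ c' _ h => (cellReflect i k).injective h]
  exact prod_congr rfl fun c _ => hcov c σ

/-- Reflecting twice returns the block set. [folklore] -/
theorem image_image_cellReflect (T : Finset (BlockIdx d N)) :
    (T.image (cellReflect i k)).image (cellReflect i k) = T := by
  rw [image_image]
  convert image_id (s := T) using 2
  funext c
  exact cellReflect_cellReflect i k c

variable [NeZero N]

/-- The positive part and the reflected positive part of a block set are disjoint (even side). [folklore] -/
theorem disjoint_inter_halfPlus_image (hN : Even N) (S : Finset (BlockIdx d N)) :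
    Disjoint (S ∩ halfPlus N i k) ((S ∩ halfPlus N i k).image (cellReflect i k)) := by
  rw [Finset.disjoint_left]
  rintro c hc hc'
  obtain ⟨c₀, hc₀, rfl⟩ := mem_image.1 hc'
  exact Finset.disjoint_left.1 (disjoint_halfPlus_halfMinus i k) (mem_inter.1 hc).2
    (cellReflect_mem_halfMinus hN (mem_inter.1 hc₀).2)

/-- The negative part and the reflected negative part of a block set are disjoint (even side). [folklore] -/
theorem disjoint_inter_halfMinus_image (hN : Even N) (S : Finset (BlockIdx d N)) :
    Disjoint (S ∩ halfMinus N i k) ((S ∩ halfMinus N i k).image (cellReflect i k)) := by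
  rw [Finset.disjoint_left]
  rintro c hc hc'
  obtain ⟨c₀, hc₀, rfl⟩ := mem_image.1 hc'
  exact Finset.disjoint_left.1 (disjoint_halfPlus_halfMinus i k) (cellReflect_mem_halfPlus hN (mem_inter.1 hc₀).2)
    (mem_inter.1 hc).2

/-- The reflected negative part lies in the positive half (even side). [folklore] -/
theorem image_inter_halfMinus_subset (hN : Even N) (S : Finset (BlockIdx d N)) :
    (S ∩ halfMinus N i k).image (cellReflect i k) ⊆ halfPlus N i k := by
  intro c hc
  obtain ⟨c₀, hc₀, rfl⟩ := mem_image.1 hc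
  exact cellReflect_mem_halfPlus hN (mem_inter.1 hc₀).2

/-- **THE SPLIT.**  `∏_{c ∈ S} b c = (∏_{S ∩ H₊} b) · ((∏_{θ(S ∩ H₋)} b) ∘ θ)`: the pattern observable of `S` is the
positive-half observable `F = ∏_{S ∩ H₊} b` times the REFLECTION of the positive-half observable
`G = ∏_{θ(S ∩ H₋)} b`. [folklore] -/
theorem prod_eq_plus_mul_comp (hcov : ∀ c σ, b c (θ σ) = b (cellReflect i k c) σ) (S : Finset (BlockIdx d N))
    (σ : Ω) :
    ∏ c ∈ S, b c σ =
      (∏ c ∈ S ∩ halfPlus N i k, b c σ) * ∏ c ∈ (S ∩ halfMinus N i k).image (cellReflect i k), b c (θ σ) := by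
  rw [prod_comp_reflect b i k hcov, image_image_cellReflect]
  have hS : S = (S ∩ halfPlus N i k) ∪ (S ∩ halfMinus N i k) := by
    rw [← inter_union_distrib_left]
    refine (inter_eq_left.2 fun c _ => ?_).symm
    exact mem_union.2 (mem_halfPlus_or_mem_halfMinus i k c)
  have hdisj : Disjoint (S ∩ halfPlus N i k) (S ∩ halfMinus N i k) :=
    (disjoint_halfPlus_halfMinus i k).mono inter_subset_right inter_subset_right
  conv_lhs => rw [hS]
  rw [prod_union hdisj]

/-- **THE POSITIVE SQUARE.**  `F · F∘θ = ∏_{symP S} b` for `F = ∏_{S ∩ H₊} b`. [folklore] -/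
theorem plus_mul_comp_eq_prod_symP (hN : Even N) (hcov : ∀ c σ, b c (θ σ) = b (cellReflect i k c) σ)
    (S : Finset (BlockIdx d N)) (σ : Ω) :
    (∏ c ∈ S ∩ halfPlus N i k, b c σ) * (∏ c ∈ S ∩ halfPlus N i k, b c (θ σ)) = ∏ c ∈ symP i k S, b c σ := by
  rw [prod_comp_reflect b i k hcov, symP, prod_union (disjoint_inter_halfPlus_image i k hN S)]

/-- **THE NEGATIVE SQUARE.**  `G · G∘θ = ∏_{symM S} b` for `G = ∏_{θ(S ∩ H₋)} b`. [folklore] -/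
theorem minus_mul_comp_eq_prod_symM (hN : Even N) (hcov : ∀ c σ, b c (θ σ) = b (cellReflect i k c) σ)
    (S : Finset (BlockIdx d N)) (σ : Ω) :
    (∏ c ∈ (S ∩ halfMinus N i k).image (cellReflect i k), b c σ) *
        (∏ c ∈ (S ∩ halfMinus N i k).image (cellReflect i k), b c (θ σ)) = ∏ c ∈ symM i k S, b c σ := by
  rw [prod_comp_reflect b i k hcov, image_image_cellReflect, symM,
    prod_union (disjoint_inter_halfMinus_image i k hN S), mul_comm]

end Products

/-! ## §2 Reflection Cauchy–Schwarz + reflection-related cells ⇒ the chessboard field -/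

section Field

variable [NeZero N] (E : (Ω → ℝ) → ℝ) (b : BlockIdx d N → Ω → ℝ) (ψ : Finset (BlockIdx d N) → ℝ)

/-- **`hcs` FROM (RP-CS) + (R-sym).**  At a block hyperplane `(i, k)` of an EVEN torus: if the state satisfies the
reflection Cauchy–Schwarz inequality for products of positive-half cell observables (`hRP`) and the cell observables are
reflection-related (`hcov`), then the pattern functional `ψ S = E (∏_{c ∈ S} b c)` obeys
`ψ S ^ 2 ≤ ψ (symP i k S) · ψ (symM i k S)` — the field `hcs` of `ChessboardEstimateEvenTorus.chessboard_pow_le_even`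
(and of W2's `HistoryChessboardDensity.density_le_of_rp`). [folklore] -/
theorem sq_le_symP_mul_symM (hN : Even N) (i : Fin d) (k : ZMod N) {θ : Ω → Ω}
    (hψ : ∀ S, ψ S = E (fun σ => ∏ c ∈ S, b c σ))
    (hcov : ∀ c σ, b c (θ σ) = b (cellReflect i k c) σ)
    (hRP : ∀ P Q : Finset (BlockIdx d N), P ⊆ halfPlus N i k → Q ⊆ halfPlus N i k →
      E (fun σ => (∏ c ∈ P, b c σ) * ∏ c ∈ Q, b c (θ σ)) ^ 2 ≤
        E (fun σ => (∏ c ∈ P, b c σ) * ∏ c ∈ P, b c (θ σ)) *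
          E (fun σ => (∏ c ∈ Q, b c σ) * ∏ c ∈ Q, b c (θ σ)))
    (S : Finset (BlockIdx d N)) :
    ψ S ^ 2 ≤ ψ (symP i k S) * ψ (symM i k S) := by
  have h := hRP (S ∩ halfPlus N i k) ((S ∩ halfMinus N i k).image (cellReflect i k)) inter_subset_right
    (image_inter_halfMinus_subset i k hN S)
  have e0 : (fun σ => (∏ c ∈ S ∩ halfPlus N i k, b c σ) *
      ∏ c ∈ (S ∩ halfMinus N i k).image (cellReflect i k), b c (θ σ)) = fun σ => ∏ c ∈ S, b c σ :=
    funext fun σ => (prod_eq_plus_mul_comp b i k hcov S σ).symm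
  have eP : (fun σ => (∏ c ∈ S ∩ halfPlus N i k, b c σ) * ∏ c ∈ S ∩ halfPlus N i k, b c (θ σ)) =
      fun σ => ∏ c ∈ symP i k S, b c σ :=
    funext fun σ => plus_mul_comp_eq_prod_symP b i k hN hcov S σ
  have eM : (fun σ => (∏ c ∈ (S ∩ halfMinus N i k).image (cellReflect i k), b c σ) *
      ∏ c ∈ (S ∩ halfMinus N i k).image (cellReflect i k), b c (θ σ)) = fun σ => ∏ c ∈ symM i k S, b c σ :=
    funext fun σ => minus_mul_comp_eq_prod_symM b i k hN hcov S σ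
  rw [e0, eP, eM] at h
  rwa [hψ S, hψ (symP i k S), hψ (symM i k S)]

/-- **`hcs_of_rpCS` — `hcs` AT EVERY HYPERPLANE** from per-hyperplane reflections: the shape W4 displays,
`∀ i k S, ψ S ^ 2 ≤ ψ (symP i k S) * ψ (symM i k S)` (owner's row W5 letter, claim table v3.19). [folklore] -/
theorem hcs_of_rpCS (hN : Even N) (θ : Fin d → ZMod N → Ω → Ω)
    (hψ : ∀ S, ψ S = E (fun σ => ∏ c ∈ S, b c σ))
    (hcov : ∀ i k c σ, b c (θ i k σ) = b (cellReflect i k c) σ)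
    (hRP : ∀ i k (P Q : Finset (BlockIdx d N)), P ⊆ halfPlus N i k → Q ⊆ halfPlus N i k →
      E (fun σ => (∏ c ∈ P, b c σ) * ∏ c ∈ Q, b c (θ i k σ)) ^ 2 ≤
        E (fun σ => (∏ c ∈ P, b c σ) * ∏ c ∈ P, b c (θ i k σ)) *
          E (fun σ => (∏ c ∈ Q, b c σ) * ∏ c ∈ Q, b c (θ i k σ))) :
    ∀ (i : Fin d) (k : ZMod N) (S : Finset (BlockIdx d N)), ψ S ^ 2 ≤ ψ (symP i k S) * ψ (symM i k S) :=
  fun i k S => sq_le_symP_mul_symM E b ψ hN i k hψ (hcov i k) (hRP i k) S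

omit [NeZero N] in
/-- The field `h0 : 0 ≤ ψ S` from a POSITIVE expectation and nonnegative cell observables. [folklore] -/
theorem nonneg_of_pos (hψ : ∀ S, ψ S = E (fun σ => ∏ c ∈ S, b c σ))
    (hE : ∀ f : Ω → ℝ, (∀ σ, 0 ≤ f σ) → 0 ≤ E f) (hb : ∀ c σ, 0 ≤ b c σ) (S : Finset (BlockIdx d N)) :
    0 ≤ ψ S := by
  rw [hψ S]
  exact hE _ fun σ => prod_nonneg fun c _ => hb c σ

omit [NeZero N] in
/-- The field `hempty : ψ ∅ ≤ 1` from a (sub)normalised expectation `E 1 ≤ 1`. [folklore] -/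
theorem empty_le_one (hψ : ∀ S, ψ S = E (fun σ => ∏ c ∈ S, b c σ)) (hE1 : E (fun _ => 1) ≤ 1) :
    ψ ∅ ≤ 1 := by
  rw [hψ ∅]
  simpa using hE1

end Field

/-! ## §3 Reflection positivity + linearity + symmetry of the reflected form ⇒ reflection Cauchy–Schwarz -/

section RP

variable (E : (Ω → ℝ) → ℝ) {θ : Ω → Ω} (Loc : (Ω → ℝ) → Prop)

/-- **(RP) ⇒ (RP-CS).**  Let `Loc` be a class of observables closed under linear combinations («positive-half
observables») on which the reflected form `⟪F, G⟫ := E (F · G∘θ)` is LINEAR IN THE LEFT SLOT (`hlin` — for an integral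
against a finite measure this is linearity on bounded measurable observables; for a genuinely linear `E` it is
automatic), SYMMETRIC (`hsymm` — in a model: `θ` an `E`-preserving involution) and POSITIVE (`hpos`, reflection
positivity `0 ≤ E (F · F∘θ)`).  Then the reflection Cauchy–Schwarz inequality
`E (f · g∘θ) ^ 2 ≤ E (f · f∘θ) · E (g · g∘θ)` holds on `Loc` — nonnegativity of the discriminant of
`t ↦ E ((f + t g) · (f + t g)∘θ)`. [folklore] -/
theorem rpCS_of_rp (hadd : ∀ f g, Loc f → Loc g → Loc (f + g)) (hsmul : ∀ (t : ℝ) f, Loc f → Loc (t • f))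
    (hlin : ∀ (F₁ F₂ G : Ω → ℝ) (t : ℝ), Loc F₁ → Loc F₂ → Loc G →
      E (fun σ => (F₁ + t • F₂) σ * G (θ σ)) = E (fun σ => F₁ σ * G (θ σ)) + t * E (fun σ => F₂ σ * G (θ σ)))
    (hsymm : ∀ F G, Loc F → Loc G → E (fun σ => F σ * G (θ σ)) = E (fun σ => G σ * F (θ σ)))
    (hpos : ∀ F, Loc F → 0 ≤ E (fun σ => F σ * F (θ σ)))
    {f g : Ω → ℝ} (hf : Loc f) (hg : Loc g) :
    E (fun σ => f σ * g (θ σ)) ^ 2 ≤ E (fun σ => f σ * f (θ σ)) * E (fun σ => g σ * g (θ σ)) := by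
  have hgf : E (fun σ => g σ * f (θ σ)) = E (fun σ => f σ * g (θ σ)) := (hsymm f g hf hg).symm
  -- the quadratic `t ↦ E ((f + t g) · (f + t g)∘θ) = c t² + 2 b t + a` is nonnegative
  have hquad : ∀ t : ℝ, 0 ≤ E (fun σ => g σ * g (θ σ)) * (t * t) + 2 * E (fun σ => f σ * g (θ σ)) * t +
      E (fun σ => f σ * f (θ σ)) := by
    intro t
    have hL : Loc (f + t • g) := hadd _ _ hf (hsmul t g hg)
    have h0 := hpos _ hL
    -- expand: ⟪f + t g, f + t g⟫ = ⟪f, f + t g⟫ + t ⟪g, f + t g⟫ = ⟪f + t g, f⟫ + t ⟪f + t g, g⟫ = …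
    rw [hlin f g (f + t • g) t hf hg hL, hsymm f (f + t • g) hf hL, hsymm g (f + t • g) hg hL,
      hlin f g f t hf hg hf, hlin f g g t hf hg hg, hgf] at h0
    nlinarith [h0]
  -- so its discriminant is nonpositive
  have hdisc := discrim_le_zero hquad
  rw [discrim] at hdisc
  nlinarith [hdisc]

variable [NeZero N]

/-- **`hcs` FROM (RP) + (R-sym)** at a block hyperplane: §2 fed by §3.  `Loc` must contain the products
`∏_{c ∈ P} b c` over positive-half block sets `P ⊆ halfPlus N i k` (hypothesis `hLocb`). [folklore] -/
theorem sq_le_symP_mul_symM_of_rp (hN : Even N) (i : Fin d) (k : ZMod N) (b : BlockIdx d N → Ω → ℝ)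
    (ψ : Finset (BlockIdx d N) → ℝ) (hψ : ∀ S, ψ S = E (fun σ => ∏ c ∈ S, b c σ))
    (hcov : ∀ c σ, b c (θ σ) = b (cellReflect i k c) σ)
    (hadd : ∀ f g, Loc f → Loc g → Loc (f + g)) (hsmul : ∀ (t : ℝ) f, Loc f → Loc (t • f))
    (hLocb : ∀ P : Finset (BlockIdx d N), P ⊆ halfPlus N i k → Loc (fun σ => ∏ c ∈ P, b c σ))
    (hlin : ∀ (F₁ F₂ G : Ω → ℝ) (t : ℝ), Loc F₁ → Loc F₂ → Loc G →
      E (fun σ => (F₁ + t • F₂) σ * G (θ σ)) = E (fun σ => F₁ σ * G (θ σ)) + t * E (fun σ => F₂ σ * G (θ σ)))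
    (hsymm : ∀ F G, Loc F → Loc G → E (fun σ => F σ * G (θ σ)) = E (fun σ => G σ * F (θ σ)))
    (hpos : ∀ F, Loc F → 0 ≤ E (fun σ => F σ * F (θ σ)))
    (S : Finset (BlockIdx d N)) :
    ψ S ^ 2 ≤ ψ (symP i k S) * ψ (symM i k S) :=
  sq_le_symP_mul_symM E b ψ hN i k hψ hcov
    (fun P Q hP hQ => rpCS_of_rp E Loc hadd hsmul hlin hsymm hpos (f := fun σ => ∏ c ∈ P, b c σ)
      (g := fun σ => ∏ c ∈ Q, b c σ) (hLocb P hP) (hLocb Q hQ)) S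

end RP

/-! ## §3b The same from the tree's bounded reflection positivity of a MEASURE (`IsReflectionPositiveBdd`) -/

section Measure

open MeasureTheory

variable {mP : MeasurableSpace Ω} [m : MeasurableSpace Ω] {μ : Measure Ω} [IsFiniteMeasure μ] {θ : Ω → Ω}

/-- A measurable involution is a measurable equivalence (its own inverse). [folklore] -/
theorem measurableEmbedding_of_involutive (hθm : Measurable θ) (hθθ : θ ∘ θ = id) : MeasurableEmbedding θ :=
  (⟨⟨θ, θ, congrFun hθθ, congrFun hθθ⟩, hθm, hθm⟩ : Ω ≃ᵐ Ω).measurableEmbedding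

/-- **`hcs` FROM THE TREE'S BOUNDED REFLECTION POSITIVITY OF A MEASURE.**  Let `μ` be a finite measure on `Ω`
(ambient σ-algebra `m`), `mP ≤ m` the σ-algebra of positive-half observables, `θ` an `m`-measurable `μ`-preserving
involution, and `μ` reflection positive in the tree's bounded form `LatticeRP.IsReflectionPositiveBdd μ mP θ` (file `LatticeRPSignRule`)
(`0 ≤ ∫ g(θω)·g(ω) dμ` for bounded `mP`-measurable `g` — the form proved for Wilson's theory by
`wilsonExpectation_reflectionPositive_holds` & co.).  If the cell observables `b c` satisfy `|b c| ≤ 1`, are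
`mP`-measurable for the cells of the positive half `halfPlus N i k` (nothing is asked of the other cells: they enter only
through reflections of positive-half products), and are reflection-related (`hcov`), then
`ψ S = ∫ ∏_{c ∈ S} b c dμ` satisfies the chessboard field `ψ S ^ 2 ≤ ψ (symP i k S) · ψ (symM i k S)`.  Proof: §3 with
`E := ∫ · dμ`, `Loc := {bounded mP-measurable}` — left-linearity = linearity of the integral on bounded measurable
functions, symmetry = `θ` measure preserving + `θ ∘ θ = id`, positivity = `IsReflectionPositiveBdd`. [folklore] -/
theorem sq_le_symP_mul_symM_of_isReflectionPositiveBdd [NeZero N] (hmP : mP ≤ m) (hθm : Measurable θ)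
    (hθ : MeasurePreserving θ μ μ) (hθθ : θ ∘ θ = id) (hRP : IsReflectionPositiveBdd μ mP θ)
    (hN : Even N) (i : Fin d) (k : ZMod N) (b : BlockIdx d N → Ω → ℝ)
    (hbP : ∀ c ∈ halfPlus N i k, Measurable[mP] (b c)) (hb1 : ∀ c ω, |b c ω| ≤ 1)
    (hcov : ∀ c ω, b c (θ ω) = b (cellReflect i k c) ω)
    (ψ : Finset (BlockIdx d N) → ℝ) (hψ : ∀ S, ψ S = ∫ ω, ∏ c ∈ S, b c ω ∂μ) (S : Finset (BlockIdx d N)) :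
    ψ S ^ 2 ≤ ψ (symP i k S) * ψ (symM i k S) := by
  -- the positive class: bounded `mP`-measurable observables
  refine sq_le_symP_mul_symM_of_rp (fun f => ∫ ω, f ω ∂μ) (fun F => Measurable[mP] F ∧ ∃ C : ℝ, ∀ ω, |F ω| ≤ C)
    hN i k b ψ hψ hcov ?_ ?_ ?_ ?_ ?_ ?_ S
  · -- closed under `+`
    rintro f g ⟨hf, Cf, hCf⟩ ⟨hg, Cg, hCg⟩
    exact ⟨hf.add hg, Cf + Cg, fun ω => (abs_add_le _ _).trans (add_le_add (hCf ω) (hCg ω))⟩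
  · -- closed under scalars
    rintro t f ⟨hf, Cf, hCf⟩
    refine ⟨hf.const_smul t, |t| * Cf, fun ω => ?_⟩
    rw [Pi.smul_apply, smul_eq_mul, abs_mul]
    exact mul_le_mul_of_nonneg_left (hCf ω) (abs_nonneg t)
  · -- contains the positive-half cell products
    intro P hP
    refine ⟨Finset.measurable_prod P fun c hc => hbP c (hP hc), 1, fun ω => ?_⟩
    rw [Finset.abs_prod]
    exact prod_le_one (fun c _ => abs_nonneg _) fun c _ => hb1 c ω
  · -- left-linearity of the reflected form = linearity of the integral on bounded measurable functions
    rintro F₁ F₂ G t ⟨hF₁, C₁, hC₁⟩ ⟨hF₂, C₂, hC₂⟩ ⟨hG, CG, hCG⟩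
    have hGθ : Measurable fun ω => G (θ ω) := (hG.mono hmP le_rfl).comp hθm
    have hI : ∀ {F : Ω → ℝ} {C : ℝ}, Measurable[mP] F → (∀ ω, |F ω| ≤ C) →
        Integrable (fun ω => F ω * G (θ ω)) μ := by
      intro F C hF hC
      refine Integrable.of_bound ((hF.mono hmP le_rfl).mul hGθ).aestronglyMeasurable (C * CG)
        (ae_of_all _ fun ω => ?_)
      rw [Real.norm_eq_abs, abs_mul]
      exact mul_le_mul (hC ω) (hCG (θ ω)) (abs_nonneg _) ((abs_nonneg _).trans (hC ω))
    have hsplit : (fun ω => (F₁ + t • F₂) ω * G (θ ω)) =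
        fun ω => F₁ ω * G (θ ω) + t * (F₂ ω * G (θ ω)) := by
      funext ω
      simp only [Pi.add_apply, Pi.smul_apply, smul_eq_mul]
      ring
    rw [hsplit, integral_add (hI hF₁ hC₁) ((hI hF₂ hC₂).const_mul t), integral_const_mul]
  · -- symmetry: `θ` measure preserving and involutive
    rintro F G ⟨hF, -, -⟩ ⟨hG, -, -⟩
    have h1 : ∫ ω, F ω * G (θ ω) ∂μ = ∫ ω, F (θ ω) * G (θ (θ ω)) ∂μ :=
      (hθ.integral_comp (measurableEmbedding_of_involutive hθm hθθ) (fun ω => F ω * G (θ ω))).symm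
    rw [h1]
    refine integral_congr_ae (ae_of_all _ fun ω => ?_)
    show F (θ ω) * G (θ (θ ω)) = G ω * F (θ ω)
    rw [show θ (θ ω) = ω from congrFun hθθ ω, mul_comm]
  · -- positivity = the tree's bounded reflection positivity
    rintro F ⟨hF, C, hC⟩
    have h := hRP F hF ⟨C, hC⟩
    simpa only [mul_comm] using h

end Measure

section Package

open MeasureTheory

/-- **THE THREE CHESSBOARD FIELDS OF W2∕W4 FROM REFLECTION POSITIVITY, PACKAGED.**  For a probability measure `μ`,
per block hyperplane `(i, k)` a positive-half σ-algebra `mP i k ≤ m`, a `μ`-preserving measurable involution `θ i k`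
with `μ` reflection positive in the tree's bounded form for `(mP i k, θ i k)`, and cell observables `0 ≤ b c ≤ 1`
(indicators of cell events) that are `mP i k`-measurable on `halfPlus N i k` and reflection-related, the pattern
functional `ψ S = ∫ ∏_{c ∈ S} b c dμ` satisfies `h0 : 0 ≤ ψ`, `hempty : ψ ∅ ≤ 1` and
`hcs : ∀ i k S, ψ S ^ 2 ≤ ψ (symP i k S) · ψ (symM i k S)` — exactly the hypotheses of
`HistoryChessboardDensity.density_le_of_rp'` (W2) displayed by W4's END as (RP-ext)+(VAR)+(R-sym). [folklore] -/
theorem chessboardFields_of_isReflectionPositiveBdd [NeZero N] [m : MeasurableSpace Ω] {μ : Measure Ω}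
    [IsProbabilityMeasure μ] (mP : Fin d → ZMod N → MeasurableSpace Ω) (hmP : ∀ i k, mP i k ≤ m)
    (θ : Fin d → ZMod N → Ω → Ω) (hθm : ∀ i k, Measurable (θ i k))
    (hθ : ∀ i k, MeasurePreserving (θ i k) μ μ) (hθθ : ∀ i k, θ i k ∘ θ i k = id)
    (hRP : ∀ i k, IsReflectionPositiveBdd μ (mP i k) (θ i k)) (hN : Even N) (b : BlockIdx d N → Ω → ℝ)
    (hbP : ∀ (i : Fin d) (k : ZMod N), ∀ c ∈ halfPlus N i k, Measurable[mP i k] (b c))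
    (hb0 : ∀ c ω, 0 ≤ b c ω) (hb1 : ∀ c ω, b c ω ≤ 1)
    (hcov : ∀ (i : Fin d) (k : ZMod N) (c : BlockIdx d N) (ω : Ω), b c (θ i k ω) = b (cellReflect i k c) ω)
    (ψ : Finset (BlockIdx d N) → ℝ) (hψ : ∀ S, ψ S = ∫ ω, ∏ c ∈ S, b c ω ∂μ) :
    (∀ S, 0 ≤ ψ S) ∧ ψ ∅ ≤ 1 ∧
      ∀ (i : Fin d) (k : ZMod N) (S : Finset (BlockIdx d N)), ψ S ^ 2 ≤ ψ (symP i k S) * ψ (symM i k S) := by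
  refine ⟨fun S => ?_, ?_, fun i k S => ?_⟩
  · rw [hψ S]
    exact integral_nonneg fun ω => prod_nonneg fun c _ => hb0 c ω
  · rw [hψ ∅]
    simp
  · exact sq_le_symP_mul_symM_of_isReflectionPositiveBdd (hmP i k) (hθm i k) (hθ i k) (hθθ i k) (hRP i k) hN i k b
      (hbP i k) (fun c ω => abs_le.2 ⟨by linarith [hb0 c ω, hb1 c ω], hb1 c ω⟩) (hcov i k) ψ hψ S

end Package


/-! ## §4 Sanity -/

namespace Sanity

/-- ARITHMETIC SHAPE OF A PLANTED NON-RP CONTROL: on the `2`-block torus in `d = 1` (`H₊ = {0}`, `θ0 = 1`) a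
state with `ψ {0} = 1∕2`, `ψ (symP 0 0 {0}) = ψ {0, 1} = 0`, `ψ (symM 0 0 {0}) = ψ ∅ = 1` VIOLATES the field at
`S = {0}` — `(1∕2)² ≤ 0 · 1` is false — as it must, since such a state violates (RP-CS) (`E (b₀ · b₀∘θ) = 0` while
`E (b₀ · 1∘θ)² = 1∕4`): the hypothesis `hRP` of §2 is load-bearing.  (Numbers only.) -/
example : ¬ ((1/2 : ℝ) ^ 2 ≤ 0 * 1) := by norm_num

/-- POSITIVE ARITHMETIC INSTANCE of the discriminant step of §3: `a = c = 1`, `b = 1/2` satisfies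
`∀ t, 0 ≤ t² + t + 1` and indeed `b² ≤ a c`. -/
example : (∀ t : ℝ, 0 ≤ 1 * (t * t) + 2 * (1/2 : ℝ) * t + 1) ∧ ((1/2 : ℝ) ^ 2 ≤ 1 * 1) := by
  refine ⟨fun t => by nlinarith [sq_nonneg (t + 1/2)], by norm_num⟩

end Sanity

end

end Summit.QuantumFields.BalabanUV.T4Continuum.HistoryChessboardRP
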